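import Literature.NumberTheory.Automorphic.IntegralWeightHeckeModuleGL2
import HarnessLib

/-!
# The weight-`k` coefficient module `V_k(𝒪) = ⨂_τ Sym^{k−2}(𝒪²) ∘ τ` of `GL₂` over a number field

Topic `NumberTheory/Automorphic` (definition request `defn-BianchiWeightModule`; wanted by
`stmt-Langlands-12920`, line `parallel-h2-eisenstein-symbol`, window (ii): weights `3 ≤ k ≤ p+1`,
and Hida control in weight `k` for `stmt-Langlands-12921`).  Namespace
`Literature.NumberTheory.Automorphic`; grouping sub-namespace `SymPowTensor` for the generic
construction; headline objects `BianchiWeightModule F 𝒪 k` and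
`bianchiWeightRep F 𝒪 k : Representation 𝒪 (GL (Fin 2) F) (BianchiWeightModule F 𝒪 k)`.

## What is constructed (no axioms, no `sorry`, no named facts)

**(A) Generic layer (`SymPowTensor`).**  For a commutative ring of coefficients `𝒪`, an index type
`J` and degrees `d : J → ℕ`, the `𝒪`-module `SymPowTensor 𝒪 J d = ⨂_{j ∈ J} Sym^{d j}(𝒪²)`
(Mathlib `PiTensorProduct` of the tree's `IntegralWeightGL2.SymPow 𝒪 m` = homogeneous forms of
degree `m` in `X₀, X₁`), and for ANY commutative ring `R` with a family of ring homomorphisms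
`τ : J → (R →+* 𝒪)` the action `SymPowTensor.action τ d` of the full matrix monoid `M₂(R)`:
`A` acts on the `j`-th factor by the tree's integral action `symPowAction 𝒪 (d j) (τ_j(A))`
(linear substitution `X_i ↦ ∑_j A_{ji} X_j`), hence the representation
`SymPowTensor.rep τ d : Representation 𝒪 (GL (Fin 2) R) (SymPowTensor 𝒪 J d)`.
This is literally the fibre module of the tree's coefficients-at-`p` datum:
`IntegralWeightGL2.IntegralWeight.CoeffModule 𝓥` is by definition `SymPowTensor 𝒪 J 𝓥.deg`.
PROVED: the action on pure tensors (`action_apply_tprod`, `rep_apply_tprod`); degree `0`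
everywhere ⇒ every matrix acts as the identity (`symPowAction_zero`, `action_eq_one`); change of
coefficients `SymPowTensor.baseChange f d : V_d(𝒪₀) →ₛₗ[f] V_d(𝒪)` along a ring homomorphism
`f : 𝒪₀ → 𝒪` (coefficientwise `MvPolynomial.map f`) and its EQUIVARIANCE along any `φ : R →+* S`
compatible with the embeddings (`baseChange_rep`: `(τ_j ∘ φ = f ∘ τ₀_j) ⇒ bc (g · v) = φ(g) · bc v`).

**(B) `GL₂` over a field `F` (headline).**  For a field `F`, a commutative ring `𝒪` and `k : ℕ`:
* `BianchiWeightModule F 𝒪 k := ⨂_{τ : F →+* 𝒪} Sym^{k−2}(𝒪²)`, indexed by ALL ring embeddings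
  `τ : F →+* 𝒪` (for `F` imaginary quadratic and `𝒪 = ℂ`, `ℚ̄_p`, `PadicAlgCl p`, or a `p`-adic
  field `E` containing both embeddings — "via `ι : ℂ ≅ ℚ̄_p`" — these are the two embeddings
  `τ, τ̄`, so `V_k = Sym^{k−2} ⊗ \overline{Sym}^{k−2}`; for `F = ℚ` the single `Sym^{k−2}`);
* `bianchiWeightRep F 𝒪 k : Representation 𝒪 (GL (Fin 2) F) (BianchiWeightModule F 𝒪 k)`,
  `γ ↦ ⨂_τ Sym^{k−2}(τ(γ))` — PARALLEL weight `k`, i.e. Berger's `M(k−2, k−2, 0, 0)`: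
  `M^n = Sym^n(F²)` with `(a b; c d)·XⁱYⁿ⁻ⁱ = (aX+cY)ⁱ(bX+dY)ⁿ⁻ⁱ`, i.e. `P ↦ P((X, Y)·A)` (= the
  tree's `linSubst` convention `X_i ↦ ∑_j A_{ji} X_j`), `\overline{M}^n` = the same after applying
  the conjugate embedding to the entries [cite: Berger2008Denominators, §2.4].  Hida's
  `L(n, v; A)` (`n = ∑_σ (k−2)σ`, `v = 0`) is the same `A`-module of polynomials in `(X_σ, Y_σ)_σ`
  homogeneous of degree `n_σ`, with `a` acting by `P ↦ P((X_σ, Y_σ) ᵗσ(a)^ι)`, `a^ι = det(a) a⁻¹`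
  [cite: Hida1994AIF, §1 (p. 1291)] — the present action precomposed with the inner automorphism
  `a ↦ w a w⁻¹`, `w = (0 1; −1 0)` (`ᵗ(a^ι) = w a w⁻¹`), an isomorphic representation.
* (i) `bianchiWeightRep_two`: `V_2` IS `Representation.trivial` (on `V_2 = ⨂_τ Sym⁰ ≅ 𝒪`), so the
  weight-2 theory of the tree (`Representation.trivial 𝒪 (GL (Fin 2) F) 𝒪` in
  `Lines/parallel-h2-eisenstein-symbol`) is the case `k = 2` up to `⨂_τ 𝒪 ≅ 𝒪`.
* (ii) `F = ℚ`: `ℚ →+* 𝒪` is a subsingleton, and for any `τ₀ : ℚ →+* 𝒪` (i.e. `char 𝒪 = 0`)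
  `bianchiWeightModuleRatEquiv : V_k(𝒪) ≃ₗ[𝒪] Sym^{k−2}(𝒪²)` intertwines `bianchiWeightRep ℚ 𝒪 k`
  with `Sym^{k−2}` of the standard representation (`bianchiWeightModuleRatEquiv_rep`): the
  representation of `GL₂` of highest weight `(k−2, 0)`, of which `GLnCohomology.coeffRepGL 𝒪 2
  ![k−2, 0]` (`CuspidalCohomologyGL`: Weyl module `S_{(k−2)}(𝒪²)`, no `det` twist since the lowest
  entry is `0`) is the Schur–Weyl model; the isomorphism `S_{(m)}(𝒪²) ≅ Sym^m(𝒪²)` (symmetric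
  tensors vs. homogeneous forms, `char 0`) is NOT formalised here (`-- TODO`).
* (iii) INTEGRAL STRUCTURE: for a ring homomorphism `f : 𝒪₀ → 𝒪` (a subring `𝒪_E ⊂ E`, the
  valuation ring of `ℚ̄_p`, …) and the restrictions `τ₀ : (F →+* 𝒪) → (𝓞 F →+* 𝒪₀)` of the
  embeddings to the integers (`f ∘ τ₀ τ = τ|_{𝓞 F}`), `BianchiWeightLattice F 𝒪 𝒪₀ k =
  ⨂_{τ} Sym^{k−2}(𝒪₀²)` with `bianchiWeightLatticeRep τ₀ k : Representation 𝒪₀ (GL (Fin 2) (𝓞 F)) _`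
  — the lattice `M(k−2,k−2,0,0)_{𝒪₀}` of polynomials with `𝒪₀`-coefficients, stable under
  `GL₂(𝓞_F)` (indeed under `M₂(𝓞_F)`) [cite: Berger2008Denominators, §2.4] — and
  `baseChange_bianchiWeightLatticeRep`: the `f`-semilinear `V_k(𝒪₀) → V_k(𝒪)` is
  `GL₂(𝓞_F) → GL₂(F)`-equivariant.  (The generic `SymPowTensor.rep` gives the same for any
  `R →+* F` in place of `𝓞 F ⊆ F`, e.g. the matrices integral at the places above `p` only, which
  is what the arithmetic groups `Γ_x = GL₂(F) ∩ xUx⁻¹` need.)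

**Use on the tree's cohomology.**  For `F` a number field and `𝒪` receiving the `τ`'s (a FIELD
`E ⊇` both embeddings, `ℚ̄_p`, `ℂ`), `bianchiWeightRep F 𝒪 k` is a representation of `Γ = GL₂(F)`
and `TwistedQuotient.cohomology (globalEmbedding 2 F) U (bianchiWeightRep F 𝒪 k) q = H^q(X_U, Ṽ_k(𝒪))`
(`CuspidalCohomologyGL`; all in `Type`, as that file requires), with
`TwistedQuotient.heckeEnd … g q = [U g U]` and `TwistedQuotient.interiorCohomology … = H^q_!` — for
`F` imaginary quadratic the weight-`k` cohomology of the Bianchi orbifolds `X_U` with its Hecke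
operators, coefficients at `∞` [cite: Berger2008Denominators, §2.4–§2.5]; by `bianchiWeightRep_two`
the case `k = 2` is the trivial-coefficient theory already used in the tree.

## Conventions, junk values, and what is deliberately NOT here

* `k < 2` is a junk input: `k − 2` is natural subtraction, so `V_0 = V_1 = V_2` (trivial).  No
  determinant twists (`M(m, n, k, ℓ)` with `(k, ℓ) ≠ 0`) and no non-parallel weights in the headline
  (`SymPowTensor.rep τ d` provides `⨂_j Sym^{d_j} ∘ τ_j` for any `d`);
  `-- TODO(general form): det^{w_τ} twists M(m,n,k,ℓ), and the dual lattice M_𝒪^∨` of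
  [cite: Berger2008Denominators, §2.4].
* THE INDEX SET IS `F →+* 𝒪`: if `𝒪` receives fewer than `[F:ℚ]` embeddings the tensor product runs
  over those it receives, and over an EMPTY index set `V_k(𝒪) = 𝒪` with the trivial action — in
  particular for every `𝒪` in which some prime is not invertible (`ℤ_p`, `𝒪_E`, the valuation ring
  of `ℚ̄_p`, `𝓞 F`: a field `F ∋ p⁻¹` has no ring homomorphism to such `𝒪`).  Integral coefficients
  are therefore ALWAYS `BianchiWeightLattice F E 𝒪₀ k` (indexed by the embeddings into the big ring
  `E ⊇ 𝒪₀`, coefficients in `𝒪₀`), never `BianchiWeightModule F 𝒪₀ k`.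
* INTEGRAL coefficients and `TwistedQuotient.cohomology`: `GL₂(F)` does not act on `V_k(𝒪₀)` for
  `𝒪₀` integral (`p⁻¹ ∈ F`), so `H^q(X_U, Ṽ_k(𝒪₀))` is NOT an instance of the coefficients-at-`∞`
  model with `Γ = GL₂(F)`: the sheaf `M̃_𝒪` is defined through the component-dependent lattices
  `M_γ = M ∩ γ M_𝒪̂` [cite: Berger2008Denominators, §2.4–§2.5].  In the tree the integral weight-`k`
  (co)homology with its Hecke operators is the coefficients-at-`p` model
  `IntegralWeightGL2.IntegralWeight.cohomology 𝓥 U i = H^i(U, V_λ(𝒪))` of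
  `IntegralWeightHeckeModuleGL2` (same fibre module `⨂_j Sym^{k_j}(𝒪²)`), compared with the present
  model after `⊗ E` by `LevelAction.sectionsEquivLevelFunctions` there; the packaged isomorphism on
  cohomology (it needs the continuous extension of each `τ : F → E` to `F_v → E`, `v ∣ p`) and flat
  base change `H(V_k(𝒪_E)) ⊗ E ≅ H(V_k(E))` are NOT formalised here.  For an arithmetic group
  `Γ ≤ GL₂(𝓞 F)`, `baseChange` induces `H^q(Γ, V_k(𝒪_E)) → H^q(Γ, V_k(E))` (Mathlib
  `groupCohomology.map`), and `H^q(Γ, N_R) ≅ H^q(Γ\ℍ, Ñ_R)` whenever the orders of the finite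
  subgroups of `Γ` are invertible in `R` [cite: Berger2008Denominators, §2.5 (Prop. 4)].
* NOT here: `Fintype (F →+* 𝒪)` / the count of embeddings (Mathlib `NumberField.Embeddings.card`
  for `𝒪` an algebraically closed field of characteristic `0`), the pairing `M × M^∨ → F`, the
  Eichler–Shimura–Harder dictionary in weight `k`, Hida's control theorem.

## References

* T. Berger, *Denominators of Eisenstein cohomology classes for GL₂ over imaginary quadratic
  fields*, Manuscripta Math. 125 (2008), §2.4 (modules `M^n = Sym^n(F²)`, `\overline{M}^n`,
  `M(m,n,k,ℓ)`, the lattice `M(m,n,k,ℓ)_𝒪`, sheaves `M̃_𝒪`), §2.5 (cohomology, Prop. 4)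
  [Berger2008Denominators].
* H. Hida, *p-adic ordinary Hecke algebras for GL(2)*, Ann. Inst. Fourier 44 (1994), §1
  (`L(n, v; A)`) [Hida1994AIF].
* G. Harder, *Eisenstein cohomology of arithmetic groups. The case GL₂*, Invent. Math. 89 (1987),
  §2 (the modules `M`) [Harder1987] (not consulted: acquisition pending; conventions follow Berger).
-/

noncomputable section

open scoped TensorProduct
open NumberField

namespace Literature.NumberTheory.Automorphic

open IntegralWeightGL2 Literature.Computability.AlgebraicComplexity

/-! ### `Sym⁰(𝒪²)` is the trivial representation -/

/-- **Every matrix acts as the identity on `Sym⁰(𝒪²) = 𝒪`** (forms of degree `0` are the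
constants, fixed by linear substitution): the weight-`2` coefficients are trivial. [folklore] -/
theorem IntegralWeightGL2.symPowAction_zero (𝒪 : Type) [CommRing 𝒪]
    (A : Matrix (Fin 2) (Fin 2) 𝒪) :
    symPowAction 𝒪 0 A = 1 := by
  refine LinearMap.ext fun f => Subtype.ext ?_
  have hf : (f : MvPolynomial (Fin 2) 𝒪).totalDegree = 0 :=
    (MvPolynomial.totalDegree_zero_iff_isHomogeneous _).2
      ((MvPolynomial.mem_homogeneousSubmodule 0 _).1 f.2)
  change linSubst (Fin 2) 𝒪 A (f : MvPolynomial (Fin 2) 𝒪) = (f : MvPolynomial (Fin 2) 𝒪)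
  rw [MvPolynomial.totalDegree_eq_zero_iff_eq_C.1 hf, linSubst_C]

/-! ### (A) `⨂_j Sym^{d_j}(𝒪²)` with `M₂(R)` acting through a family of ring homomorphisms -/

/-- **`V_d(𝒪) = ⨂_{j ∈ J} Sym^{d j}(𝒪²)`** (Mathlib `PiTensorProduct` over `𝒪` of the tree's
`SymPow 𝒪 m`): the underlying `𝒪`-module of the weight-`d` coefficient systems of `GL₂` over a
number field (one factor per embedding `j`), Berger's `M^{m} ⊗ \overline{M}^{n}` for `J` the two
embeddings of an imaginary quadratic field.  A `def` carrying its own `AddCommGroup`/`Module`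
instances (one instance path, so that representations on it feed `TwistedQuotient.cohomology`;
the same device as `GLnCohomology.CoeffModule`), and literally the fibre module
`IntegralWeightGL2.IntegralWeight.CoeffModule` of the coefficients-at-`p` model.
[cite: Berger2008Denominators, §2.4] -/
def SymPowTensor (𝒪 : Type) [CommRing 𝒪] (J : Type) (d : J → ℕ) : Type :=
  ⨂[𝒪] j : J, SymPow 𝒪 (d j)

namespace SymPowTensor

/-- `V_d(𝒪)` is an additive group (that of the tensor product). [folklore] -/
instance (𝒪 : Type) [CommRing 𝒪] (J : Type) (d : J → ℕ) : AddCommGroup (SymPowTensor 𝒪 J d) :=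
  inferInstanceAs (AddCommGroup (⨂[𝒪] j : J, SymPow 𝒪 (d j)))

/-- `V_d(𝒪)` is an `𝒪`-module (that of the tensor product). [folklore] -/
instance (𝒪 : Type) [CommRing 𝒪] (J : Type) (d : J → ℕ) : Module 𝒪 (SymPowTensor 𝒪 J d) :=
  inferInstanceAs (Module 𝒪 (⨂[𝒪] j : J, SymPow 𝒪 (d j)))

variable {𝒪 : Type} [CommRing 𝒪] {J : Type}

/-- Pure tensors `⊗_j x_j ∈ V_d(𝒪)` (`PiTensorProduct.tprod`). [folklore] -/
def tprod {d : J → ℕ} (x : ∀ j, SymPow 𝒪 (d j)) : SymPowTensor 𝒪 J d :=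
  PiTensorProduct.tprod 𝒪 x

/-- Induction on `V_d(𝒪)`: it suffices to treat multiples of pure tensors and sums
(`PiTensorProduct.induction_on`). [folklore] -/
@[elab_as_elim]
protected theorem induction_on {d : J → ℕ} {motive : SymPowTensor 𝒪 J d → Prop}
    (v : SymPowTensor 𝒪 J d)
    (smul_tprod : ∀ (r : 𝒪) (x : ∀ j, SymPow 𝒪 (d j)), motive (r • tprod x))
    (add : ∀ v w, motive v → motive w → motive (v + w)) : motive v :=
  PiTensorProduct.induction_on (motive := motive) v smul_tprod add

/-- Two `𝒪`-linear maps out of `V_d(𝒪)` agreeing on pure tensors are equal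
(`PiTensorProduct.ext`). [folklore] -/
theorem hom_ext {d : J → ℕ} {E : Type} [AddCommGroup E] [Module 𝒪 E]
    {φ₁ φ₂ : SymPowTensor 𝒪 J d →ₗ[𝒪] E}
    (h : ∀ x : ∀ j, SymPow 𝒪 (d j), φ₁ (tprod x) = φ₂ (tprod x)) : φ₁ = φ₂ :=
  PiTensorProduct.ext (R := 𝒪) (s := fun j => SymPow 𝒪 (d j)) (MultilinearMap.ext fun x => h x)

section Action

variable {R : Type} [CommRing R] (τ : J → (R →+* 𝒪)) (d : J → ℕ)

/-- **The action of the matrix monoid `M₂(R)` on `V_d(𝒪)` through the embeddings `τ`**: `A` acts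
on the `j`-th factor `Sym^{d j}(𝒪²)` by the integral action `symPowAction` of the matrix
`τ_j(A) ∈ M₂(𝒪)` (entrywise), and factorwise on the tensor product (`PiTensorProduct.map`).
Defined for all matrices, invertible or not. [cite: Berger2008Denominators, §2.4] -/
def action : Matrix (Fin 2) (Fin 2) R →* Module.End 𝒪 (SymPowTensor 𝒪 J d) :=
  show Matrix (Fin 2) (Fin 2) R →* Module.End 𝒪 (⨂[𝒪] j : J, SymPow 𝒪 (d j)) from
    PiTensorProduct.mapMonoidHom.comp
      (MonoidHom.pi fun j => (symPowAction 𝒪 (d j)).comp (τ j).mapMatrix.toMonoidHom)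

/-- The action on pure tensors is factorwise: `A · ⊗_j x_j = ⊗_j τ_j(A) · x_j`. [folklore] -/
@[simp]
theorem action_apply_tprod (A : Matrix (Fin 2) (Fin 2) R) (x : ∀ j, SymPow 𝒪 (d j)) :
    action τ d A (tprod x) = tprod fun j => symPowAction 𝒪 (d j) ((τ j).mapMatrix A) (x j) :=
  PiTensorProduct.map_tprod _ _

/-- **`V_d(𝒪)` as a representation of `GL₂(R)`** (restriction of `action` to invertible matrices):
`g ↦ ⨂_j Sym^{d j}(τ_j(g))`. For `R = F` a number field and `τ` its embeddings into `𝒪` this is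
the coefficient system of weight `(d_τ + 2)_τ`; for `R = 𝓞 F` (or matrices integral at `p`) and
`𝒪` integral it is the lattice `M_𝒪`. [cite: Berger2008Denominators, §2.4] -/
def rep : Representation 𝒪 (GL (Fin 2) R) (SymPowTensor 𝒪 J d) :=
  (action τ d).comp (Units.coeHom (Matrix (Fin 2) (Fin 2) R))

/-- Unfolding lemma: `rep τ d g = action τ d ↑g`. [folklore] -/
theorem rep_apply (g : GL (Fin 2) R) :
    rep τ d g = action τ d (g : Matrix (Fin 2) (Fin 2) R) :=
  rfl

/-- The representation on pure tensors: `g · ⊗_j x_j = ⊗_j τ_j(g) · x_j`. [folklore] -/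
@[simp]
theorem rep_apply_tprod (g : GL (Fin 2) R) (x : ∀ j, SymPow 𝒪 (d j)) :
    rep τ d g (tprod x) =
      tprod fun j => symPowAction 𝒪 (d j) ((τ j).mapMatrix (g : Matrix (Fin 2) (Fin 2) R)) (x j) :=
  action_apply_tprod τ d _ x

/-- **In degree `0` every matrix acts trivially**: if `d j = 0` for all `j` then
`action τ d A = 1` (`V_d = ⨂_j Sym⁰ = ⨂_j 𝒪` is the trivial module). [folklore] -/
theorem action_eq_one (hd : ∀ j, d j = 0) (A : Matrix (Fin 2) (Fin 2) R) : action τ d A = 1 := by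
  have h0 : ∀ m : ℕ, m = 0 → ∀ B : Matrix (Fin 2) (Fin 2) 𝒪, symPowAction 𝒪 m B = 1 := by
    rintro m rfl B
    exact symPowAction_zero 𝒪 B
  have h1 : (MonoidHom.pi fun j => (symPowAction 𝒪 (d j)).comp (τ j).mapMatrix.toMonoidHom) A = 1 :=
    funext fun j => h0 (d j) (hd j) _
  change PiTensorProduct.mapMonoidHom
    ((MonoidHom.pi fun j => (symPowAction 𝒪 (d j)).comp (τ j).mapMatrix.toMonoidHom) A) = _
  rw [h1]
  exact map_one _

/-- In degree `0` the representation is trivial: `rep τ d = Representation.trivial`. [folklore] -/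
theorem rep_eq_trivial (hd : ∀ j, d j = 0) :
    rep τ d = Representation.trivial 𝒪 (GL (Fin 2) R) (SymPowTensor 𝒪 J d) :=
  MonoidHom.ext fun _ => action_eq_one τ d hd _

end Action

/-! #### Change of coefficients `𝒪₀ → 𝒪` and its equivariance -/

section BaseChange

variable {𝒪₀ : Type} [CommRing 𝒪₀] (f : 𝒪₀ →+* 𝒪) (d : J → ℕ)

/-- `Sym^m(𝒪₀²) → Sym^m(𝒪²)` along a ring homomorphism `f : 𝒪₀ → 𝒪`: `MvPolynomial.map f` of the
coefficients (it preserves homogeneity, `MvPolynomial.IsHomogeneous.map`); `f`-semilinear.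
[folklore] -/
def symPowBaseChange (m : ℕ) : SymPow 𝒪₀ m →ₛₗ[f] SymPow 𝒪 m where
  toFun p := ⟨MvPolynomial.map f (p : MvPolynomial (Fin 2) 𝒪₀),
    (MvPolynomial.mem_homogeneousSubmodule m _).2
      (((MvPolynomial.mem_homogeneousSubmodule m _).1 p.2).map _)⟩
  map_add' p q := Subtype.ext (by simp)
  map_smul' r p := Subtype.ext (by
    change MvPolynomial.map f (r • (p : MvPolynomial (Fin 2) 𝒪₀)) =
      f r • MvPolynomial.map f (p : MvPolynomial (Fin 2) 𝒪₀)
    rw [MvPolynomial.smul_eq_C_mul, map_mul, MvPolynomial.map_C, MvPolynomial.smul_eq_C_mul])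

/-- Unfolding lemma for `symPowBaseChange`. [folklore] -/
@[simp]
theorem coe_symPowBaseChange (m : ℕ) (p : SymPow 𝒪₀ m) :
    ((symPowBaseChange f m p : SymPow 𝒪 m) : MvPolynomial (Fin 2) 𝒪) =
      MvPolynomial.map f (p : MvPolynomial (Fin 2) 𝒪₀) :=
  rfl

/-- **Change of coefficients commutes with linear substitution**:
`map f (linSubst A p) = linSubst (f A) (map f p)`. [folklore] -/
theorem map_linSubst (A : Matrix (Fin 2) (Fin 2) 𝒪₀) (p : MvPolynomial (Fin 2) 𝒪₀) :
    MvPolynomial.map f (linSubst (Fin 2) 𝒪₀ A p) =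
      linSubst (Fin 2) 𝒪 (f.mapMatrix A) (MvPolynomial.map f p) := by
  simp only [linSubst, MvPolynomial.aeval_eq_bind₁, MvPolynomial.map_bind₁, map_sum,
    MvPolynomial.smul_eq_C_mul, map_mul, MvPolynomial.map_C, MvPolynomial.map_X,
    RingHom.mapMatrix_apply, Matrix.map_apply]

/-- `symPowBaseChange` intertwines the integral actions of `A ∈ M₂(𝒪₀)` and of `f(A) ∈ M₂(𝒪)`.
[folklore] -/
theorem symPowBaseChange_symPowAction (m : ℕ) (A : Matrix (Fin 2) (Fin 2) 𝒪₀) (p : SymPow 𝒪₀ m) :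
    symPowBaseChange f m (symPowAction 𝒪₀ m A p) =
      symPowAction 𝒪 m (f.mapMatrix A) (symPowBaseChange f m p) :=
  Subtype.ext (map_linSubst f A p)

/-- The `𝒪₀`-LINEAR change of coefficients `Sym^m(𝒪₀²) → Sym^m(𝒪²)` when `𝒪` is an
`𝒪₀`-algebra (`symPowBaseChange (algebraMap 𝒪₀ 𝒪)`, for the restricted `𝒪₀`-structure on
`Sym^m(𝒪²)`). [folklore] -/
def symPowBaseChangeₗ [Algebra 𝒪₀ 𝒪] (m : ℕ) : SymPow 𝒪₀ m →ₗ[𝒪₀] SymPow 𝒪 m where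
  toFun := symPowBaseChange (algebraMap 𝒪₀ 𝒪) m
  map_add' := map_add _
  map_smul' r p := by
    rw [LinearMap.map_smulₛₗ, RingHom.id_apply]
    exact algebraMap_smul 𝒪 r _

/-- The `𝒪₀`-LINEAR change of coefficients on the tensor products (raw `PiTensorProduct` types,
where Mathlib's `𝒪₀`-structure on `⨂[𝒪]` is available): `PiTensorProduct.lift` of the pure-tensor
map restricted to `𝒪₀`, precomposed factorwise with `symPowBaseChangeₗ`. [folklore] -/
def baseChangeₗ [Algebra 𝒪₀ 𝒪] (d : J → ℕ) :
    (⨂[𝒪₀] j : J, SymPow 𝒪₀ (d j)) →ₗ[𝒪₀] ⨂[𝒪] j : J, SymPow 𝒪 (d j) :=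
  PiTensorProduct.lift
    (((PiTensorProduct.tprod 𝒪 (s := fun j => SymPow 𝒪 (d j))).restrictScalars 𝒪₀).compLinearMap
      fun j => symPowBaseChangeₗ (d j))

/-- `baseChangeₗ` on pure tensors. [folklore] -/
theorem baseChangeₗ_tprod [Algebra 𝒪₀ 𝒪] (d : J → ℕ) (x : ∀ j, SymPow 𝒪₀ (d j)) :
    baseChangeₗ d (PiTensorProduct.tprod 𝒪₀ x) =
      PiTensorProduct.tprod 𝒪 fun j => symPowBaseChangeₗ (d j) (x j) :=
  PiTensorProduct.lift.tprod x

/-- **Change of coefficients `V_d(𝒪₀) → V_d(𝒪)`** along a ring homomorphism `f : 𝒪₀ → 𝒪`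
(factorwise `symPowBaseChange`; `baseChangeₗ` for the algebra structure `f.toAlgebra`, repackaged
as an `f`-SEMILINEAR map between the `SymPowTensor` types): the map `M_{𝒪₀} → M_{𝒪₀} ⊗ 𝒪 = M_𝒪`,
`N_A = N ⊗_𝒪 A`. [cite: Berger2008Denominators, §2.4] -/
def baseChange : SymPowTensor 𝒪₀ J d →ₛₗ[f] SymPowTensor 𝒪 J d :=
  letI : Algebra 𝒪₀ 𝒪 := f.toAlgebra
  { toFun := fun v => baseChangeₗ d v
    map_add' := fun v w => (baseChangeₗ d).map_add v w
    map_smul' := fun r v =>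
      ((baseChangeₗ d).map_smul r v).trans (algebraMap_smul 𝒪 r (baseChangeₗ d v)).symm }

/-- `baseChange` on pure tensors is factorwise change of coefficients. [folklore] -/
@[simp]
theorem baseChange_tprod (x : ∀ j, SymPow 𝒪₀ (d j)) :
    baseChange f d (tprod x) = tprod fun j => symPowBaseChange f (d j) (x j) := by
  letI : Algebra 𝒪₀ 𝒪 := f.toAlgebra
  exact baseChangeₗ_tprod d x

/-- **Equivariance of the change of coefficients.**  Let `φ : R →+* S` (e.g. `𝓞 F ⊆ F`),
`τ₀ : J → (R →+* 𝒪₀)`, `τ' : J → (S →+* 𝒪)` with `τ'_j ∘ φ = f ∘ τ₀_j` for all `j`.  Then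
`baseChange (g · v) = φ(g) · baseChange v` for `g ∈ GL₂(R)`: the image of `V_d(𝒪₀)` in `V_d(𝒪)`
is a `GL₂(R)`-stable `𝒪₀`-structure. [cite: Berger2008Denominators, §2.4] -/
theorem baseChange_rep {R S : Type} [CommRing R] [CommRing S] (φ : R →+* S) (τ₀ : J → (R →+* 𝒪₀))
    (τ' : J → (S →+* 𝒪)) (hτ : ∀ j, (τ' j).comp φ = f.comp (τ₀ j))
    (g : GL (Fin 2) R) (v : SymPowTensor 𝒪₀ J d) :
    baseChange f d (rep τ₀ d g v) =
      rep τ' d (Matrix.GeneralLinearGroup.map φ g) (baseChange f d v) := by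
  induction v using SymPowTensor.induction_on with
  | smul_tprod r x =>
    rw [map_smul, LinearMap.map_smulₛₗ, LinearMap.map_smulₛₗ, map_smul, rep_apply_tprod,
      baseChange_tprod, baseChange_tprod, rep_apply_tprod]
    congr 1
    refine congrArg tprod (funext fun j => ?_)
    rw [symPowBaseChange_symPowAction]
    congr 2
    ext a b
    have h := RingHom.congr_fun (hτ j) ((g : Matrix (Fin 2) (Fin 2) R) a b)
    simpa using h.symm
  | add x y hx hy => rw [map_add, map_add, hx, hy, map_add, map_add]

end BaseChange

end SymPowTensor

/-! ### (B) `GL₂` over a field: the parallel weight-`k` module `V_k(𝒪)` -/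

section Bianchi

variable (F 𝒪 : Type) [Field F] [CommRing 𝒪]

/-- **`V_k(𝒪) = ⨂_{τ : F →+* 𝒪} Sym^{k−2}(𝒪²)`**, the parallel weight-`k` coefficient module of
`GL₂` over the field `F` with coefficients in `𝒪`, one symmetric power for each ring embedding
`τ : F → 𝒪` (`F` imaginary quadratic, `𝒪 ⊇` both embeddings: `Sym^{k−2} ⊗ \overline{Sym}^{k−2}`,
Berger's `M(k−2, k−2, 0, 0)`).  Junk inputs: `k < 2` (natural subtraction, `V_k = V_2`); `𝒪`
receiving no embedding (`V_k = 𝒪` trivial — every INTEGRAL `𝒪`; use `BianchiWeightLattice`).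
[cite: Berger2008Denominators, §2.4] -/
abbrev BianchiWeightModule (k : ℕ) : Type :=
  SymPowTensor 𝒪 (F →+* 𝒪) fun _ => k - 2

/-- **The representation `bianchiWeightRep F 𝒪 k : GL₂(F) → GL(V_k(𝒪))`**,
`γ ↦ ⨂_τ Sym^{k−2}(τ(γ))`: each embedding `τ` acts on its own factor through the standard
representation on linear forms (`(a b; c d)·XⁱYⁿ⁻ⁱ = (aX+cY)ⁱ(bX+dY)ⁿ⁻ⁱ`), NO determinant twist.
Plugged into `TwistedQuotient.cohomology (globalEmbedding 2 F) U (bianchiWeightRep F 𝒪 k) q` it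
gives `H^q(X_U, Ṽ_k(𝒪))` with its Hecke operators `TwistedQuotient.heckeEnd` (coefficients at `∞`;
`𝒪` a field containing the embeddings). [cite: Berger2008Denominators, §2.4] -/
def bianchiWeightRep (k : ℕ) : Representation 𝒪 (GL (Fin 2) F) (BianchiWeightModule F 𝒪 k) :=
  SymPowTensor.rep (fun τ : F →+* 𝒪 => τ) fun _ => k - 2

variable {F 𝒪}

/-- `bianchiWeightRep` on pure tensors: `γ · ⊗_τ x_τ = ⊗_τ Sym^{k−2}(τ(γ)) x_τ`. [folklore] -/
@[simp]
theorem bianchiWeightRep_apply_tprod (k : ℕ) (g : GL (Fin 2) F)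
    (x : (F →+* 𝒪) → SymPow 𝒪 (k - 2)) :
    bianchiWeightRep F 𝒪 k g (SymPowTensor.tprod x) =
      SymPowTensor.tprod fun τ => symPowAction 𝒪 (k - 2)
        (τ.mapMatrix (g : Matrix (Fin 2) (Fin 2) F)) (x τ) :=
  SymPowTensor.rep_apply_tprod _ _ g x

variable (F 𝒪) in
/-- **(i) Weight `2` is trivial coefficients**: `bianchiWeightRep F 𝒪 2 = Representation.trivial`
(on `V_2 = ⨂_τ Sym⁰(𝒪²)`). [folklore] -/
theorem bianchiWeightRep_two :
    bianchiWeightRep F 𝒪 2 = Representation.trivial 𝒪 (GL (Fin 2) F) (BianchiWeightModule F 𝒪 2) :=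
  SymPowTensor.rep_eq_trivial _ _ fun _ => rfl

/-! #### (ii) `F = ℚ`: `V_k = Sym^{k−2}` of the standard representation -/

/-- For `F = ℚ` there is at most one embedding `ℚ → 𝒪` (`Rat.subsingleton_ringHom`); given one,
`τ₀` (i.e. `char 𝒪 = 0`), `V_k(𝒪) = ⨂_{τ : ℚ →+* 𝒪} Sym^{k−2}(𝒪²) ≃ₗ[𝒪] Sym^{k−2}(𝒪²)`
(`PiTensorProduct.subsingletonEquiv`). [folklore] -/
def bianchiWeightModuleRatEquiv (𝒪 : Type) [CommRing 𝒪] (τ₀ : ℚ →+* 𝒪) (k : ℕ) :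
    BianchiWeightModule ℚ 𝒪 k ≃ₗ[𝒪] SymPow 𝒪 (k - 2) :=
  show (⨂[𝒪] _ : ℚ →+* 𝒪, SymPow 𝒪 (k - 2)) ≃ₗ[𝒪] SymPow 𝒪 (k - 2) from
    PiTensorProduct.subsingletonEquiv τ₀

/-- `bianchiWeightModuleRatEquiv` on pure tensors: `⊗_τ x_τ ↦ x_{τ₀}`. [folklore] -/
@[simp]
theorem bianchiWeightModuleRatEquiv_tprod (𝒪 : Type) [CommRing 𝒪] (τ₀ : ℚ →+* 𝒪) (k : ℕ)
    (x : (ℚ →+* 𝒪) → SymPow 𝒪 (k - 2)) :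
    bianchiWeightModuleRatEquiv 𝒪 τ₀ k (SymPowTensor.tprod x) = x τ₀ :=
  PiTensorProduct.subsingletonEquiv_apply_tprod τ₀ x

/-- **(ii) Compatibility with `GL₂/ℚ`**: under `bianchiWeightModuleRatEquiv`, `bianchiWeightRep ℚ 𝒪 k`
is `Sym^{k−2}` of the standard representation of `GL₂(ℚ)` (through `τ₀ : ℚ → 𝒪`), the
representation of highest weight `(k−2, 0)` — the tree's `GLnCohomology.coeffRepGL 𝒪 2 ![k−2, 0]`
is its Schur–Weyl model (`-- TODO: the isomorphism weylModule (k−2) ≅ SymPow (k−2)`). [folklore] -/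
theorem bianchiWeightModuleRatEquiv_rep (𝒪 : Type) [CommRing 𝒪] (τ₀ : ℚ →+* 𝒪) (k : ℕ)
    (g : GL (Fin 2) ℚ) (v : BianchiWeightModule ℚ 𝒪 k) :
    bianchiWeightModuleRatEquiv 𝒪 τ₀ k (bianchiWeightRep ℚ 𝒪 k g v) =
      symPowAction 𝒪 (k - 2) (τ₀.mapMatrix (g : Matrix (Fin 2) (Fin 2) ℚ))
        (bianchiWeightModuleRatEquiv 𝒪 τ₀ k v) := by
  induction v using SymPowTensor.induction_on with
  | smul_tprod r x =>
    rw [map_smul, map_smul, map_smul, map_smul, bianchiWeightRep_apply_tprod,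
      bianchiWeightModuleRatEquiv_tprod, bianchiWeightModuleRatEquiv_tprod]
  | add x y hx hy => rw [map_add, map_add, hx, hy, map_add, map_add]

/-! #### (iii) The integral structure `V_k(𝒪₀) → V_k(𝒪)`, stable under `GL₂(𝓞_F)` -/

variable (F 𝒪) in
/-- **The lattice `V_k(𝒪₀) = ⨂_{τ : F →+* 𝒪} Sym^{k−2}(𝒪₀²)`** (polynomials with coefficients in a
smaller ring `𝒪₀`, e.g. `𝒪_E ⊂ E`, the valuation ring of `ℚ̄_p`, or `𝓞 F`-algebras), indexed by the
SAME embeddings `F → 𝒪`: Berger's `M(k−2,k−2,0,0)_𝒪`. [cite: Berger2008Denominators, §2.4] -/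
abbrev BianchiWeightLattice (𝒪₀ : Type) [CommRing 𝒪₀] (k : ℕ) : Type :=
  SymPowTensor 𝒪₀ (F →+* 𝒪) fun _ => k - 2

/-- **`GL₂(𝓞_F)` acting on the lattice `V_k(𝒪₀)`** through the restrictions
`τ₀ τ : 𝓞 F →+* 𝒪₀` of the embeddings to the integers: the `𝒪₀[GL₂(𝓞_F)]`-module
`M(k−2,k−2,0,0)_{𝒪₀}` (stable even under `M₂(𝓞_F)`, `SymPowTensor.action`).
[cite: Berger2008Denominators, §2.4] -/
def bianchiWeightLatticeRep {𝒪₀ : Type} [CommRing 𝒪₀] (τ₀ : (F →+* 𝒪) → (𝓞 F →+* 𝒪₀)) (k : ℕ) :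
    Representation 𝒪₀ (GL (Fin 2) (𝓞 F)) (BianchiWeightLattice F 𝒪 𝒪₀ k) :=
  SymPowTensor.rep τ₀ fun _ => k - 2

/-- **(iii) The integral structure is `GL₂(𝓞_F)`-equivariant**: if `f : 𝒪₀ → 𝒪` is a ring
homomorphism and each `τ₀ τ` is the restriction of `τ` (`f ∘ τ₀ τ = τ|_{𝓞 F}`), then the
(`f`-semilinear) change of coefficients `V_k(𝒪₀) → V_k(𝒪)` intertwines
`bianchiWeightLatticeRep τ₀ k` on `GL₂(𝓞_F)` with `bianchiWeightRep F 𝒪 k` on its image in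
`GL₂(F)`. [cite: Berger2008Denominators, §2.4] -/
theorem baseChange_bianchiWeightLatticeRep {𝒪₀ : Type} [CommRing 𝒪₀] (f : 𝒪₀ →+* 𝒪)
    (τ₀ : (F →+* 𝒪) → (𝓞 F →+* 𝒪₀))
    (hτ : ∀ τ : F →+* 𝒪, τ.comp (algebraMap (𝓞 F) F) = f.comp (τ₀ τ))
    (k : ℕ) (g : GL (Fin 2) (𝓞 F)) (v : BianchiWeightLattice F 𝒪 𝒪₀ k) :
    SymPowTensor.baseChange f (fun _ => k - 2) (bianchiWeightLatticeRep τ₀ k g v) =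
      bianchiWeightRep F 𝒪 k (Matrix.GeneralLinearGroup.map (algebraMap (𝓞 F) F) g)
        (SymPowTensor.baseChange f (fun _ => k - 2) v) :=
  SymPowTensor.baseChange_rep f _ (algebraMap (𝓞 F) F) τ₀ (fun τ : F →+* 𝒪 => τ) hτ g v

end Bianchi

end Literature.NumberTheory.Automorphic
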